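import Summits.AtomisticToContinuum.HydrodynamicLimit.Theses.RelayRaceLocality
import Literature.MathematicalPhysics.KineticTheory.HardSphereEulerSolutionGluing
import Literature.Analysis.FunctionSpaces.TorusSpaceTime

/-!
# `RestartPrinciple` (stmt-AtomisticToContinuum-12503): the consequent implies the antecedent, so
# `¬ RestartPrinciple ↔ (S ∧ ¬ G)`

Negative-side structure of the standing disprover (`Cruxes/RestartPrinciple/Disproof.lean` §1–2),
route `RelayRaceLocality`. The crux `RelayRaceLocality.RestartPrinciple` is LITERALLY the implication
`S → G` (`Iff.rfl`), where
* `S` = the short-time guarded hydrodynamic limit from local-Gibbs time-0 data (prefix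
  `∃ η₀ ∀ M ∃ τ₁ ∀ profile ∃ σ₀ ∀ σ < σ₀`; = the conclusion of the route's glue `ConeLocalisation`),
* `G` = the packing-guarded conjunct (verbatim the shared item stmt-AtomisticToContinuum-3093 /
  `GermanoSplitLES.HydroLimitInBand`).
Both are spelled out below (no new `def`).

* `exists_packing_extension` — a strict packing bound `ρ σ³ < η₀` on the compact slab `[0, t] × 𝕋³`
  of a classical hard-sphere Euler solution on `[0, T)`, `t < T`, extends to `[0, T')` for some
  `T' ∈ (t, T]` (max over the compact torus at time `t`; tube lemma
  `IsSmoothSpaceTimeOn.eventually_norm_sub_lt` in time).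
* `guardedConjunct_imp_shortTimeGuardedHL : G → S` — TIGHTNESS of the crux: restrict the solution to
  `[0, T')` (`IsHardSphereEulerSolution.restrict`) and apply `G` there; the size guards of `S` are
  not even used, only its packing guard on `[0, t]`.
* `not_restartPrinciple_iff : ¬ RestartPrinciple ↔ (S ∧ ¬ G)` — WHAT A DISPROOF OF THE CRUX IS:
  exactly a proof of the short-time hydrodynamic limit `S` together with a refutation of the
  packing-guarded conjunct `G`. Both halves are junk-free hydrodynamic-limit statements (the laws are
  `≪ liouville`, degenerate horizons `T ≤ 0` are vacuous on both sides), which is why the crux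
  resists refutation; equivalently `RestartPrinciple ↔ (S ↔ G)`.

refuter-cdisprove-stmt-AtomisticToContinuum-12503-0, 2026-08-16.
-/

noncomputable section

namespace Summit.AtomisticToContinuum.HydrodynamicLimit.Theorems.RestartPrincipleNegative

open Literature.MathematicalPhysics.KineticTheory Literature.Analysis.FluidPDE
open Literature.Analysis.FunctionSpaces MeasureTheory Filter Set Topology
open Summit.AtomisticToContinuum.HydrodynamicLimit.Theses.RelayRaceLocality

/-- A strict packing bound on the compact slab `[0, t] × 𝕋³` of a classical solution on `[0, T)`,
`t < T`, extends to `[0, T')` for some `T' ∈ (t, T]`. -/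
theorem exists_packing_extension {σ T : ℝ} {ρ θ : ℝ → T3 → ℝ} {u : ℝ → T3 → V3}
    (h : IsHardSphereEulerSolution σ T ρ u θ) {η₀ t : ℝ} (ht : t ∈ Ico 0 T)
    (hpack : ∀ s ∈ Icc 0 t, ∀ x, ρ s x * σ ^ 3 < η₀) (hσ : 0 < σ) :
    ∃ T' : ℝ, t < T' ∧ T' ≤ T ∧ ∀ s ∈ Ico 0 T', ∀ x, ρ s x * σ ^ 3 < η₀ := by
  have hcont : Continuous (ρ t) := (h.smooth_density.isSmooth_slice ht).continuous
  obtain ⟨x₀, -, hx₀⟩ := isCompact_univ.exists_isMaxOn univ_nonempty hcont.continuousOn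
  have hσ3 : 0 < σ ^ 3 := pow_pos hσ 3
  have hR : ρ t x₀ < η₀ / σ ^ 3 := by
    rw [lt_div_iff₀ hσ3]
    exact hpack t ⟨ht.1, le_rfl⟩ x₀
  set ε : ℝ := (η₀ / σ ^ 3 - ρ t x₀) / 2 with hε
  have hεpos : 0 < ε := by rw [hε]; linarith
  have hev := h.smooth_density.eventually_norm_sub_lt ht hεpos
  obtain ⟨δ, hδ, hδε⟩ := Metric.mem_nhdsWithin_iff.1 hev
  refine ⟨min T (t + δ), lt_min ht.2 (by linarith), min_le_left _ _, fun s hs x => ?_⟩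
  by_cases hst : s ≤ t
  · exact hpack s ⟨hs.1, hst⟩ x
  · push Not at hst
    have hsT : s ∈ Ico 0 T := ⟨hs.1, lt_of_lt_of_le hs.2 (min_le_left _ _)⟩
    have hdist : s ∈ Metric.ball t δ := by
      rw [Metric.mem_ball, Real.dist_eq, abs_of_pos (sub_pos.2 hst)]
      linarith [lt_of_lt_of_le hs.2 (min_le_right _ _)]
    have hmem : s ∈ {s | ∀ x, ‖ρ s x - ρ t x‖ < ε} := hδε ⟨hdist, hsT⟩
    have hnear : ‖ρ s x - ρ t x‖ < ε := hmem x
    have h1 : ρ s x < ρ t x + ε := by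
      rw [Real.norm_eq_abs] at hnear
      linarith [(abs_lt.1 hnear).2]
    have h2 : ρ t x ≤ ρ t x₀ := hx₀ (mem_univ x)
    have h3 : ρ t x₀ + ε < η₀ / σ ^ 3 := by rw [hε]; linarith
    have h4 : ρ s x < η₀ / σ ^ 3 := by linarith
    rwa [lt_div_iff₀ hσ3] at h4

/-- TIGHTNESS: the packing-guarded conjunct `G` (consequent of the crux) implies the short-time
guarded limit `S` (its antecedent). -/
theorem guardedConjunct_imp_shortTimeGuardedHL :
    (∃ η₀ : ℝ, 0 < η₀ ∧ ∀ (a₀ θ₀ : T3 → ℝ) (u₀ : T3 → V3), Continuous a₀ → Continuous θ₀ → Continuous u₀ → (∀ x, 0 < a₀ x) → (∀ x, 0 < θ₀ x) → ∃ σ₀ : ℝ, 0 < σ₀ ∧ ∀ σ : ℝ, 0 < σ → σ < σ₀ → ∀ (T : ℝ) (ρ θ : ℝ → T3 → ℝ) (u : ℝ → T3 → V3), IsHardSphereEulerSolution σ T ρ u θ → (∀ t ∈ Set.Ico 0 T, ∀ x, ρ t x * σ ^ 3 < η₀) → ∀ Φ : (N : ℕ) → HardSphereFlow (Torus.geometry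 (Fin 3)) (hsDiameter σ N) (N + 1), TendstoHydroFieldsAt (fun N => localGibbsLaw σ a₀ u₀ θ₀ N (Φ N)) Φ ρ u θ 0 → ∀ t ∈ Set.Ico 0 T, TendstoHydroFieldsAt (fun N => localGibbsLaw σ a₀ u₀ θ₀ N (Φ N)) Φ ρ u θ t) →
    (∃ η₀ : ℝ, 0 < η₀ ∧ ∀ M : ℝ, 0 < M → ∃ τ₁ : ℝ, 0 < τ₁ ∧ ∀ (a₀ θ₀ : T3 → ℝ) (u₀ : T3 → V3), Continuous a₀ → Continuous θ₀ → Continuous u₀ → (∀ x, 0 < a₀ x) → (∀ x, 0 < θ₀ x) → ∃ σ₀ : ℝ, 0 < σ₀ ∧ ∀ σ : ℝ, 0 < σ → σ < σ₀ → ∀ (T : ℝ) (ρ θ : ℝ → T3 → ℝ) (u : ℝ → T3 → V3), IsHardSphereEulerSolution σ T ρ u θ → ∀ Φ : (N : ℕ) → HardSphereFlow (Torus.geometry (Fin 3)) (hsDiameter σ N) (N + 1), TendstoHydroFieldsAt (fun N => localGibbsLaw σ a₀ u₀ θ₀ N (Φ N)) Φ ρ u θ 0 → ∀ t ∈ Set.Ico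 0 (min T τ₁), (∀ s ∈ Set.Icc 0 t, ∀ x, ρ s x * σ ^ 3 < η₀ ∧ ρ s x ≤ M ∧ θ s x ≤ M ∧ M⁻¹ ≤ θ s x ∧ ‖u s x‖ ≤ M ∧ ∀ i j k : Fin 3, |Torus.partialDeriv i (ρ s) x| ≤ M ∧ ‖Torus.partialDeriv i (u s) x‖ ≤ M ∧ |Torus.partialDeriv i (θ s) x| ≤ M ∧ |Torus.partialDeriv i (Torus.partialDeriv j (ρ s)) x| ≤ M ∧ ‖Torus.partialDeriv i (Torus.partialDeriv j (u s)) x‖ ≤ M ∧ |Torus.partialDeriv i (Torus.partialDeriv j (θ s)) x| ≤ M ∧ |Torus.partialDeriv i (Torus.partialDeriv j (Torus.partialDeriv k (ρ s))) x| ≤ M ∧ ‖Torus.partialDeriv i (Torus.partialDeriv j (Torus.partialDeriv k (u s))) x‖ ≤ M ∧ |Torus.partialDeriv i (Torus.partialDeriv j (Torus.partialDeriv k (θ s))) x| ≤ M) → TendstoHydroFieldsAt (fun N => localGibbsLaw σ a₀ u₀ θ₀ N (Φ N)) Φ ρ u θ t) := by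
  rintro ⟨η₀, hη₀, hG⟩
  refine ⟨η₀, hη₀, fun M _ => ⟨1, one_pos, fun a₀ θ₀ u₀ ha hθ hu ha0 hθ0 => ?_⟩⟩
  obtain ⟨σ₀, hσ₀, hG⟩ := hG a₀ θ₀ u₀ ha hθ hu ha0 hθ0
  refine ⟨σ₀, hσ₀, fun σ hσ hσσ₀ T ρ θ u hsol Φ h0 t ht hguard => ?_⟩
  have htT : t ∈ Ico 0 T := ⟨ht.1, lt_of_lt_of_le ht.2 (min_le_left _ _)⟩
  obtain ⟨T', htT', hT'T, hpack⟩ :=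
    exists_packing_extension hsol htT (fun s hs x => (hguard s hs x).1) hσ
  exact hG σ hσ hσσ₀ T' ρ θ u (hsol.restrict hT'T) hpack Φ h0 t ⟨ht.1, htT'⟩

/-- WHAT A DISPROOF OF THE CRUX IS: `¬ RestartPrinciple ↔ (S ∧ ¬ G)` — a proof of the short-time
guarded hydrodynamic limit `S` together with a refutation of the packing-guarded conjunct `G`. -/
theorem not_restartPrinciple_iff :
    ¬ RestartPrinciple ↔
    ((∃ η₀ : ℝ, 0 < η₀ ∧ ∀ M : ℝ, 0 < M → ∃ τ₁ : ℝ, 0 < τ₁ ∧ ∀ (a₀ θ₀ : T3 → ℝ) (u₀ : T3 → V3), Continuous a₀ → Continuous θ₀ → Continuous u₀ → (∀ x, 0 < a₀ x) → (∀ x, 0 < θ₀ x) → ∃ σ₀ : ℝ, 0 < σ₀ ∧ ∀ σ : ℝ, 0 < σ → σ < σ₀ → ∀ (T : ℝ) (ρ θ : ℝ → T3 → ℝ) (u : ℝ → T3 → V3), IsHardSphereEulerSolution σ T ρ u θ → ∀ Φ : (N : ℕ) → HardSphereFlow (Torus.geometry (Fin 3)) (hsDiameter σ N) (N + 1), TendstoHydroFieldsAt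 (fun N => localGibbsLaw σ a₀ u₀ θ₀ N (Φ N)) Φ ρ u θ 0 → ∀ t ∈ Set.Ico 0 (min T τ₁), (∀ s ∈ Set.Icc 0 t, ∀ x, ρ s x * σ ^ 3 < η₀ ∧ ρ s x ≤ M ∧ θ s x ≤ M ∧ M⁻¹ ≤ θ s x ∧ ‖u s x‖ ≤ M ∧ ∀ i j k : Fin 3, |Torus.partialDeriv i (ρ s) x| ≤ M ∧ ‖Torus.partialDeriv i (u s) x‖ ≤ M ∧ |Torus.partialDeriv i (θ s) x| ≤ M ∧ |Torus.partialDeriv i (Torus.partialDeriv j (ρ s)) x| ≤ M ∧ ‖Torus.partialDeriv i (Torus.partialDeriv j (u s)) x‖ ≤ M ∧ |Torus.partialDeriv i (Torus.partialDeriv j (θ s)) x| ≤ M ∧ |Torus.partialDeriv i (Torus.partialDeriv j (Torus.partialDeriv k (ρ s))) x| ≤ M ∧ ‖Torus.partialDeriv i (Torus.partialDeriv j (Torus.partialDeriv k (u s))) x‖ ≤ M ∧ |Torus.partialDeriv i (Torus.partialDeriv j (Torus.partialDeriv k (θ s))) x| ≤ M) → TendstoHydroFieldsAt (fun N => localGibbsLaw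 σ a₀ u₀ θ₀ N (Φ N)) Φ ρ u θ t) ∧
     ¬ (∃ η₀ : ℝ, 0 < η₀ ∧ ∀ (a₀ θ₀ : T3 → ℝ) (u₀ : T3 → V3), Continuous a₀ → Continuous θ₀ → Continuous u₀ → (∀ x, 0 < a₀ x) → (∀ x, 0 < θ₀ x) → ∃ σ₀ : ℝ, 0 < σ₀ ∧ ∀ σ : ℝ, 0 < σ → σ < σ₀ → ∀ (T : ℝ) (ρ θ : ℝ → T3 → ℝ) (u : ℝ → T3 → V3), IsHardSphereEulerSolution σ T ρ u θ → (∀ t ∈ Set.Ico 0 T, ∀ x, ρ t x * σ ^ 3 < η₀) → ∀ Φ : (N : ℕ) → HardSphereFlow (Torus.geometry (Fin 3)) (hsDiameter σ N) (N + 1), TendstoHydroFieldsAt (fun N => localGibbsLaw σ a₀ u₀ θ₀ N (Φ N)) Φ ρ u θ 0 → ∀ t ∈ Set.Ico 0 T, TendstoHydroFieldsAt (fun N => localGibbsLaw σ a₀ u₀ θ₀ N (Φ N)) Φ ρ u θ t)) :=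
  Classical.not_imp

/-- Equivalently, the crux FAILS only if its two halves are inequivalent; since `G → S`
unconditionally, `¬ RestartPrinciple` pins `S` true and `G` false. -/
theorem not_restartPrinciple_iff_not_iff :
    ¬ RestartPrinciple ↔
    ¬ ((∃ η₀ : ℝ, 0 < η₀ ∧ ∀ M : ℝ, 0 < M → ∃ τ₁ : ℝ, 0 < τ₁ ∧ ∀ (a₀ θ₀ : T3 → ℝ) (u₀ : T3 → V3), Continuous a₀ → Continuous θ₀ → Continuous u₀ → (∀ x, 0 < a₀ x) → (∀ x, 0 < θ₀ x) → ∃ σ₀ : ℝ, 0 < σ₀ ∧ ∀ σ : ℝ, 0 < σ → σ < σ₀ → ∀ (T : ℝ) (ρ θ : ℝ → T3 → ℝ) (u : ℝ → T3 → V3), IsHardSphereEulerSolution σ T ρ u θ → ∀ Φ : (N : ℕ) → HardSphereFlow (Torus.geometry (Fin 3)) (hsDiameter σ N) (N + 1), TendstoHydroFieldsAt (fun N => localGibbsLaw σ a₀ u₀ θ₀ N (Φ N)) Φ ρ u θ 0 → ∀ t ∈ Set.Ico 0 (min T τ₁), (∀ s ∈ Set.Icc 0 t, ∀ x, ρ s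 x * σ ^ 3 < η₀ ∧ ρ s x ≤ M ∧ θ s x ≤ M ∧ M⁻¹ ≤ θ s x ∧ ‖u s x‖ ≤ M ∧ ∀ i j k : Fin 3, |Torus.partialDeriv i (ρ s) x| ≤ M ∧ ‖Torus.partialDeriv i (u s) x‖ ≤ M ∧ |Torus.partialDeriv i (θ s) x| ≤ M ∧ |Torus.partialDeriv i (Torus.partialDeriv j (ρ s)) x| ≤ M ∧ ‖Torus.partialDeriv i (Torus.partialDeriv j (u s)) x‖ ≤ M ∧ |Torus.partialDeriv i (Torus.partialDeriv j (θ s)) x| ≤ M ∧ |Torus.partialDeriv i (Torus.partialDeriv j (Torus.partialDeriv k (ρ s))) x| ≤ M ∧ ‖Torus.partialDeriv i (Torus.partialDeriv j (Torus.partialDeriv k (u s))) x‖ ≤ M ∧ |Torus.partialDeriv i (Torus.partialDeriv j (Torus.partialDeriv k (θ s))) x| ≤ M) → TendstoHydroFieldsAt (fun N => localGibbsLaw σ a₀ u₀ θ₀ N (Φ N)) Φ ρ u θ t) ↔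
       (∃ η₀ : ℝ, 0 < η₀ ∧ ∀ (a₀ θ₀ : T3 → ℝ) (u₀ : T3 → V3), Continuous a₀ → Continuous θ₀ → Continuous u₀ → (∀ x, 0 < a₀ x) → (∀ x, 0 < θ₀ x) → ∃ σ₀ : ℝ, 0 < σ₀ ∧ ∀ σ : ℝ, 0 < σ → σ < σ₀ → ∀ (T : ℝ) (ρ θ : ℝ → T3 → ℝ) (u : ℝ → T3 → V3), IsHardSphereEulerSolution σ T ρ u θ → (∀ t ∈ Set.Ico 0 T, ∀ x, ρ t x * σ ^ 3 < η₀) → ∀ Φ : (N : ℕ) → HardSphereFlow (Torus.geometry (Fin 3)) (hsDiameter σ N) (N + 1), TendstoHydroFieldsAt (fun N => localGibbsLaw σ a₀ u₀ θ₀ N (Φ N)) Φ ρ u θ 0 → ∀ t ∈ Set.Ico 0 T, TendstoHydroFieldsAt (fun N => localGibbsLaw σ a₀ u₀ θ₀ N (Φ N)) Φ ρ u θ t)) := by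
  rw [not_restartPrinciple_iff]
  constructor
  · rintro ⟨hS, hG⟩ h
    exact hG (h.1 hS)
  · intro h
    by_contra h'
    apply h
    constructor
    · intro hS
      by_contra hG
      exact h' ⟨hS, hG⟩
    · exact guardedConjunct_imp_shortTimeGuardedHL

end Summit.AtomisticToContinuum.HydrodynamicLimit.Theorems.RestartPrincipleNegative

end
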